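import Literature.NumberTheory.EllipticCurves.ZpExtensionScalarTwistFiniteProofs
import HarnessLib

/-!
# The monomials `1, T, …, T^{m-1}` generate `Λ/(q_m)` over `ℤ_p`, `A_{m,k} = Λ/(q_m, p^k)` over `ℤ`, and every
# element of Howard's `M ⊗ A_{m,k}(ψ)` is `∑_{i<m} T^i ⊗ a_i` (proofs file)

Topic `NumberTheory/EllipticCurves` (companion of `IwasawaAlgebraEisensteinFiniteQuotientProofs` and
`ZpExtensionScalarTwistFiniteProofs`). THEOREMS ONLY (no definition, no named fact, no instance, no `sorry`).

WHAT. `q_m = T^m + p` (`m ≥ 1`) is distinguished, so by Weierstrass division (Mathlib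
`PowerSeries.IsWeierstrassDivisorAt`, `Polynomial.IsDistinguishedAt.isWeierstrassDivisorAt'`) every power series is
congruent modulo `q_m` to a polynomial of degree `< m`:
* §1 `exists_polynomial_degree_lt_sub_coe_mem_span_qm` (`∀ F ∈ Λ, ∃ r ∈ ℤ_p[X], deg r < m ∧ F − r ∈ (q_m)`),
  `exists_sub_sum_C_mul_X_pow_mem_span_qm` (every `F` is congruent mod `q_m` to `∑_{i<m} c_i T^i`, `c_i ∈ ℤ_p`);
* §2 in `A_{m,k} = Λ/(q_m, p^k)`: `exists_eq_sum_nsmul_mk_X_pow` (every element is `∑_{i<m} n_i · [T^i]` with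
  NATURAL numbers `n_i < p^k`, Mathlib `PadicInt.appr`), hence `span_int_range_mk_X_pow_eq_top` (the classes
  `[T^i]`, `i < m`, generate `A_{m,k}` as an abelian group) — `A_{m,k} = ⊕_{i<m} (ℤ/p^k)·T^i` up to the (not
  proved here) independence;
* §3 for the carrier `EisensteinCoeff.Twisted p m k M = M ⊗ A_{m,k}` of Howard's `T_𝔮/p^k T_𝔮`
  [Howard 2004, §2.2]: `Twisted.zsmul_tmul` / `Twisted.nsmul_tmul` (integer scalars move across `⊗`),
  **`exists_eq_sum_tmul_mk_X_pow`** (every element is `∑_{i<m} [T^i] ⊗ a_i`, `a_i ∈ M`: the coordinate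
  surjection `M^m ↠ M ⊗ A_{m,k}`) and `natCard_twisted_le_natCard_pow` (`#(M ⊗ A_{m,k}) ≤ #M^m` for finite `M`;
  for `M = E[p^k]`: `#(T_𝔮/p^k T_𝔮) ≤ p^{2km}`).

WHY. The coordinates `M^m ↠ M ⊗ A_{m,k}` are how local conditions and counts for `T_𝔮/p^k = E[p^k] ⊗ A_{m,k}(ψ)`
reduce to the tree's `E[p^k]`-valued Kummer/cohomology machinery (over `K_∞` the twist is trivial and the
module is `E[p^k]^m` coordinatewise) — cell `pub/bsd-print-x9`, D1/S1 road of the shared μ-residual. Pure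
algebra; nothing about Galois cohomology is asserted. BSD is not proved by any of this.

References: [Howard2004HeegnerKolyvagin] B. Howard, Compositio Math. 140 (2004), §2.2 and proof of Thm. 2.2.10
(`𝔮 = T^m + p`, `S_𝔮 = Λ/𝔮 = ℤ_p[π]`); [Washington1997] §7.1 (Prop. 7.2, division by distinguished polynomials),
§13.2; [Lang1980] Ch. 5 §2 Thm. 2.1 (Euclidean algorithm in `Λ`).
-/

noncomputable section

open scoped Classical Polynomial

universe w

namespace Literature.NumberTheory.EllipticCurves.IwasawaAlgebra

variable (p : ℕ) [hp : Fact p.Prime]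

/-! ## §1 Weierstrass division by `q_m`: remainders of degree `< m` -/

/-- The reduction of `q_m = T^m + p` modulo the maximal ideal of `ℤ_p` is `T^m`, of order `m`.
[cite: Washington1997, §7.1 (distinguished polynomials)] -/
theorem order_map_coe_X_pow_add_C (m : ℕ) :
    (((Polynomial.X ^ m + Polynomial.C (p : ℤ_[p]) : ℤ_[p][X]) : IwasawaAlgebra p).map
        (Ideal.Quotient.mk (IsLocalRing.maximalIdeal ℤ_[p]))).order.toNat = m := by
  haveI : Nontrivial (ℤ_[p] ⧸ IsLocalRing.maximalIdeal ℤ_[p]) :=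
    Ideal.Quotient.nontrivial_iff.mpr (Ideal.IsMaximal.ne_top inferInstance)
  have hp0 : Ideal.Quotient.mk (IsLocalRing.maximalIdeal ℤ_[p]) (p : ℤ_[p]) = 0 :=
    Ideal.Quotient.eq_zero_iff_mem.mpr (by
      rw [PadicInt.maximalIdeal_eq_span_p]; exact Ideal.mem_span_singleton_self _)
  rw [coe_X_pow_add_C, map_add, map_pow, PowerSeries.map_X, PowerSeries.map_C, hp0, map_zero, add_zero,
    PowerSeries.order_X_pow]
  rfl

/-- **Weierstrass division by `q_m`**: every `F ∈ Λ` is congruent modulo `q_m = T^m + p` (`m ≥ 1`) to a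
polynomial of degree `< m`. [cite: Washington1997, §7.1 (Prop. 7.2)] [cite: Lang1980, Ch. 5 §2 Thm. 2.1] -/
theorem exists_polynomial_degree_lt_sub_coe_mem_span_qm {m : ℕ} (hm : 1 ≤ m) (F : IwasawaAlgebra p) :
    ∃ r : ℤ_[p][X], r.degree < m ∧
      F - (r : IwasawaAlgebra p) ∈
        Ideal.span {(PowerSeries.X ^ m + PowerSeries.C (p : ℤ_[p]) : IwasawaAlgebra p)} := by
  have hq := isDistinguishedAt_X_pow_add_C p hm
  have H := hq.isWeierstrassDivisorAt' (A := ℤ_[p])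
  have hdiv := H.isWeierstrassDivisionAt_div_mod F
  refine ⟨H.mod F, ?_, ?_⟩
  · have h := hdiv.degree_lt
    rwa [order_map_coe_X_pow_add_C p m] at h
  · rw [← coe_X_pow_add_C, Ideal.mem_span_singleton]
    refine ⟨H.div F, ?_⟩
    have h := hdiv.eq_mul_add
    calc F - (H.mod F : IwasawaAlgebra p)
        = ((Polynomial.X ^ m + Polynomial.C (p : ℤ_[p]) : ℤ_[p][X]) : IwasawaAlgebra p) * H.div F +
            (H.mod F : IwasawaAlgebra p) - (H.mod F : IwasawaAlgebra p) := by rw [← h]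
      _ = ((Polynomial.X ^ m + Polynomial.C (p : ℤ_[p]) : ℤ_[p][X]) : IwasawaAlgebra p) * H.div F := by ring

/-- Every class of `Λ/(q_m)` is represented by `∑_{i<m} c_i T^i` with `c_i ∈ ℤ_p` (the monomials `T^i`, `i < m`,
span `S_𝔮 = Λ/q_m = ℤ_p[π]` over `ℤ_p`). [cite: Washington1997, §7.1 (Prop. 7.2) and §13.2]
[cite: Howard2004HeegnerKolyvagin, proof of Thm. 2.2.10 (S_𝔮 = Λ/𝔮 for 𝔮 = T^m + p)] -/
theorem exists_sub_sum_C_mul_X_pow_mem_span_qm {m : ℕ} (hm : 1 ≤ m) (F : IwasawaAlgebra p) :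
    ∃ c : Fin m → ℤ_[p],
      F - ∑ i : Fin m, PowerSeries.C (c i) * PowerSeries.X ^ (i : ℕ) ∈
        Ideal.span {(PowerSeries.X ^ m + PowerSeries.C (p : ℤ_[p]) : IwasawaAlgebra p)} := by
  obtain ⟨r, hr, hF⟩ := exists_polynomial_degree_lt_sub_coe_mem_span_qm p hm F
  refine ⟨fun i ↦ r.coeff i, ?_⟩
  have hnat : r.natDegree < m := by
    by_cases hr0 : r = 0
    · rw [hr0, Polynomial.natDegree_zero]; omega
    · exact (Polynomial.natDegree_lt_iff_degree_lt hr0).mpr hr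
  have hsum : (r : IwasawaAlgebra p) = ∑ i : Fin m, PowerSeries.C (r.coeff i) * PowerSeries.X ^ (i : ℕ) := by
    conv_lhs => rw [r.as_sum_range_C_mul_X_pow' hnat]
    rw [← Polynomial.coeToPowerSeries.ringHom_apply, map_sum, ← Fin.sum_univ_eq_sum_range]
    refine Finset.sum_congr rfl fun i _ ↦ ?_
    rw [map_mul, map_pow, Polynomial.coeToPowerSeries.ringHom_apply, Polynomial.coeToPowerSeries.ringHom_apply,
      Polynomial.coe_C, Polynomial.coe_X]
  rwa [hsum] at hF

/-! ## §2 `A_{m,k}` is generated over `ℤ` by `[1], [T], …, [T^{m-1}]` -/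

/-- **Every element of `A_{m,k} = Λ/(q_m, p^k)` is `∑_{i<m} n_i · [T^i]` with natural numbers `n_i < p^k`**
(Weierstrass division, then `ℤ_p`-coefficients approximated modulo `p^k` by Mathlib `PadicInt.appr`).
[cite: Washington1997, §7.1 (Prop. 7.2) and §13.2] [cite: Howard2004HeegnerKolyvagin, §2.2] -/
theorem exists_eq_sum_nsmul_mk_X_pow {m : ℕ} (hm : 1 ≤ m) (k : ℕ) (a : EisensteinCoeff p m k) :
    ∃ n : Fin m → ℕ, (∀ i, n i < p ^ k) ∧
      a = ∑ i : Fin m, n i • (Ideal.Quotient.mk _ (PowerSeries.X ^ (i : ℕ)) : EisensteinCoeff p m k) := by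
  obtain ⟨F, rfl⟩ := Ideal.Quotient.mk_surjective a
  obtain ⟨c, hc⟩ := exists_sub_sum_C_mul_X_pow_mem_span_qm p hm F
  refine ⟨fun i ↦ (c i).appr k, fun i ↦ PadicInt.appr_lt _ _, ?_⟩
  -- `[F] = [∑ C(c_i) T^i]`
  have h1 : (Ideal.Quotient.mk _ F : EisensteinCoeff p m k) =
      Ideal.Quotient.mk _ (∑ i : Fin m, PowerSeries.C (c i) * PowerSeries.X ^ (i : ℕ)) := by
    rw [Ideal.Quotient.eq]
    exact Ideal.mem_sup_left hc
  -- `[C(c_i) T^i] = appr(c_i) • [T^i]`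
  have h2 : ∀ i : Fin m, (Ideal.Quotient.mk _ (PowerSeries.C (c i) * PowerSeries.X ^ (i : ℕ)) :
      EisensteinCoeff p m k) = (c i).appr k • Ideal.Quotient.mk _ (PowerSeries.X ^ (i : ℕ)) := by
    intro i
    rw [nsmul_eq_mul, ← map_natCast (Ideal.Quotient.mk _), ← map_mul, Ideal.Quotient.eq, ← sub_mul]
    refine Ideal.mem_sup_right (Ideal.mul_mem_right _ _ ?_)
    have h := PadicInt.appr_spec k (c i)
    rw [Ideal.mem_span_singleton] at h ⊢
    obtain ⟨d, hd⟩ := h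
    refine ⟨PowerSeries.C d, ?_⟩
    rw [← map_mul, ← hd, map_sub, map_natCast]
  rw [h1, map_sum]
  exact Finset.sum_congr rfl fun i _ ↦ h2 i

/-- **The classes `[T^i]`, `i < m`, generate `A_{m,k}` as an abelian group.**
[cite: Washington1997, §7.1 (Prop. 7.2) and §13.2] [cite: Howard2004HeegnerKolyvagin, §2.2] -/
theorem span_int_range_mk_X_pow_eq_top {m : ℕ} (hm : 1 ≤ m) (k : ℕ) :
    Submodule.span ℤ (Set.range fun i : Fin m ↦
      (Ideal.Quotient.mk _ (PowerSeries.X ^ (i : ℕ)) : EisensteinCoeff p m k)) = ⊤ := by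
  rw [eq_top_iff]
  rintro a -
  obtain ⟨n, -, rfl⟩ := exists_eq_sum_nsmul_mk_X_pow p hm k a
  refine Submodule.sum_mem _ fun i _ ↦ ?_
  rw [← natCast_zsmul]
  exact Submodule.smul_mem _ _ (Submodule.subset_span ⟨i, rfl⟩)

/-- The classes `[T^i]`, `i < m`, generate `A_{m,k}` as an additive monoid (natural-number combinations suffice).
[cite: Washington1997, §7.1 (Prop. 7.2) and §13.2] -/
theorem closure_range_mk_X_pow_eq_top {m : ℕ} (hm : 1 ≤ m) (k : ℕ) :
    AddSubmonoid.closure (Set.range fun i : Fin m ↦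
      (Ideal.Quotient.mk _ (PowerSeries.X ^ (i : ℕ)) : EisensteinCoeff p m k)) = ⊤ := by
  rw [eq_top_iff]
  rintro a -
  obtain ⟨n, -, rfl⟩ := exists_eq_sum_nsmul_mk_X_pow p hm k a
  refine AddSubmonoid.sum_mem _ fun i _ ↦ AddSubmonoid.nsmul_mem _ (AddSubmonoid.subset_closure (Set.mem_range_self i)) _

/-! ## §3 Coordinates `M^m ↠ M ⊗ A_{m,k}` -/

namespace EisensteinCoeff

variable {p} {m k : ℕ} {M : Type w} [AddCommGroup M]

/-- `(n • c) ⊗ a = c ⊗ (n • a)` for `n : ℤ`. [cite: Howard2004HeegnerKolyvagin, §2.2 (T_𝔮 = 𝐓 ⊗_Λ S_𝔮)] -/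
theorem Twisted.zsmul_tmul (n : ℤ) (c : EisensteinCoeff p m k) (a : M) :
    (Twisted.tmul (n • c) a : Twisted p m k M) = Twisted.tmul c (n • a) := by
  rw [Twisted.tmul_zsmul]
  exact map_zsmul (AddMonoidHom.mk' (fun c : EisensteinCoeff p m k ↦ (Twisted.tmul c a : Twisted p m k M))
    (fun c c' ↦ Twisted.add_tmul c c' a)) n c

/-- `(n • c) ⊗ a = c ⊗ (n • a)` for `n : ℕ`. [cite: Howard2004HeegnerKolyvagin, §2.2 (T_𝔮 = 𝐓 ⊗_Λ S_𝔮)] -/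
theorem Twisted.nsmul_tmul (n : ℕ) (c : EisensteinCoeff p m k) (a : M) :
    (Twisted.tmul (n • c) a : Twisted p m k M) = Twisted.tmul c (n • a) := by
  rw [← natCast_zsmul, Twisted.zsmul_tmul, natCast_zsmul]

/-- **Coordinates**: every element of `M ⊗ A_{m,k}` is `∑_{i<m} [T^i] ⊗ a_i` with `a_i ∈ M` (`m ≥ 1`) — the
`ℤ`-linear map `M^m → M ⊗ A_{m,k}`, `(a_i) ↦ ∑ [T^i] ⊗ a_i`, is onto. For `M = E[p^k]`: every element of
`T_𝔮/p^k T_𝔮` is `∑_{i<m} π^i ⊗ P_i`, `P_i ∈ E[p^k]`. [cite: Howard2004HeegnerKolyvagin, §2.2 and proof of Thm. 2.2.10 (S_𝔮 = ℤ_p[π])]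
[cite: Washington1997, §13.2] -/
theorem exists_eq_sum_tmul_mk_X_pow (hm : 1 ≤ m) (x : Twisted p m k M) :
    ∃ a : Fin m → M, x = ∑ i : Fin m,
      Twisted.tmul (Ideal.Quotient.mk _ (PowerSeries.X ^ (i : ℕ)) : EisensteinCoeff p m k) (a i) := by
  induction x using Twisted.induction_on with
  | zero => exact ⟨0, by simp only [Pi.zero_apply, Twisted.tmul_zero, Finset.sum_const_zero]⟩
  | tmul c b =>
    obtain ⟨n, -, rfl⟩ := exists_eq_sum_nsmul_mk_X_pow p hm k c
    refine ⟨fun i ↦ n i • b, ?_⟩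
    have hf := map_sum (AddMonoidHom.mk' (fun c : EisensteinCoeff p m k ↦ (Twisted.tmul c b : Twisted p m k M))
      (fun c c' ↦ Twisted.add_tmul c c' b))
      (fun i : Fin m ↦ n i • (Ideal.Quotient.mk _ (PowerSeries.X ^ (i : ℕ)) : EisensteinCoeff p m k)) Finset.univ
    refine hf.trans (Finset.sum_congr rfl fun i _ ↦ ?_)
    exact Twisted.nsmul_tmul (n i) _ b
  | add x y hx hy =>
    obtain ⟨a, rfl⟩ := hx
    obtain ⟨b, rfl⟩ := hy
    refine ⟨a + b, ?_⟩
    rw [← Finset.sum_add_distrib]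
    exact Finset.sum_congr rfl fun i _ ↦ (Twisted.tmul_add _ (a i) (b i)).symm

/-- **`#(M ⊗ A_{m,k}) ≤ #M^m` for finite `M`** (`m ≥ 1`; the coordinate surjection `M^m ↠ M ⊗ A_{m,k}`). For
`M = E[p^k]` (`#E[p^k] = p^{2k}` over `K̄`): `#(T_𝔮/p^k T_𝔮) ≤ p^{2km}`. [cite: Howard2004HeegnerKolyvagin, §2.2 and proof of Thm. 2.2.10]
[cite: Washington1997, §13.2] -/
theorem natCard_twisted_le_natCard_pow [Finite M] (hm : 1 ≤ m) :
    Nat.card (Twisted p m k M) ≤ Nat.card M ^ m := by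
  let Φ : (Fin m → M) → Twisted p m k M := fun a ↦ ∑ i : Fin m,
    Twisted.tmul (Ideal.Quotient.mk _ (PowerSeries.X ^ (i : ℕ)) : EisensteinCoeff p m k) (a i)
  have hΦ : Function.Surjective Φ := fun x ↦ by
    obtain ⟨a, rfl⟩ := exists_eq_sum_tmul_mk_X_pow (p := p) (k := k) hm x
    exact ⟨a, rfl⟩
  calc Nat.card (Twisted p m k M) ≤ Nat.card (Fin m → M) := Nat.card_le_card_of_surjective Φ hΦ
    _ = Nat.card M ^ m := by rw [Nat.card_pi, Finset.prod_const, Finset.card_univ, Fintype.card_fin]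

end EisensteinCoeff

end Literature.NumberTheory.EllipticCurves.IwasawaAlgebra

end
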